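/-
Copyright (c) 2026 the pub-hodgecm-mathlib formalisation cell (harness21).  Prover seat hodgecm-mathlib-F0P2-p10 (g2), Track B «K2-LIT»,
#184♮ = hLiu418 = `stmt-HodgeConjecture-24832`; socket #41, KIND 1, organ (K1b-W), seam (KW1-e) PART 2b = (e2′): KUDLA'S SEE-SAW CHART PRESERVES INTEGRALITY PLACE BY PLACE
(the `m = 0` case of (KW1-c)'s by-value letter `hιK`, K2Liu-p14 (g4) LINE WORD #1 (3)(i)).  THEOREMS ONLY (no `def`, no `instance`, no notation, no named-fact hypothesis, no `sorry`).
-/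
import Summits.HodgeConjecture.HodgeConjecture.Theorems.K2LiuBlockDiagPlaces   -- ★ (e2) p862695: `coe_evalPlace_finPart_blkD` (place components of `blkD`)
import HarnessLib

/-!
# Crux `HLiu418`, socket #41, KIND 1 ∕ (K1b-W), seam (KW1-e) PART 2b — `K2LiuBlockDiagIntegral`: `(blkD (h₁,h₂))_v ∈ K_v ↔ (h₁)_v ∈ K⁽ᴬ⁾_v ∧ (h₂)_v ∈ K⁽ᴮ⁾_v`,
# hence the exceptional place set of the translated corner family is `T(g) ∪ {v : y_v ∉ K⁽ᴮ⁾_v}`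

Cell `hodgecm-mathlib`, crux item hLiu418 = `stmt-HodgeConjecture-24832` (route of record `HCCMUnconditional`); squad K2 ∕ K2Liu, road `K2_Liu`, socket #41, KIND 1,
K1-b♮ line term; (K1b-W) line lead K2Liu-p14 (g4) (LINE WORD #1 2026-09-04T22:42:47Z: currency `Φ^{(p₀,g)} s x = f s (p₀ · blkD(1,x) · g)`, letters indexed by `g ∈ H(𝔸)`,
exceptional set `T(g) = T₀ ∪ {v : g_v ∉ K_v}`; (3)(i) «`ι(K₁(m)) ⊆ K(m)` for `ι = blkD(1,·)` … BY VALUE as `hιK` until (e2) is ★»), K1 desk F0P2-p11 (g2).  THIS FILE pays the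
level-`0` case of `hιK` and the place bookkeeping of (e3): the `v`-component of `blkD (h₁, h₂)` is integral iff both components are (★ (e2) `coe_evalPlace_finPart_blkD`: it is the GL-matrix
`reindexGL σ⁻¹ (blockDiagGL ((h₁)_v, (h₂)_v))`, whose entries and inverse entries are those of the two blocks and zeros).
THEOREMS ONLY; lane `--supports stmt-HodgeConjecture-24832 --as helper` (count-neutral).
* §1 (generic, any valued field) **`reindexGL_blockDiagGL_mem_glInt_iff`** — `reindexGL e (blockDiagGL (X₁, X₂)) ∈ GL_k(𝒪) ↔ X₁ ∈ GL_{k₁}(𝒪) ∧ X₂ ∈ GL_{k₂}(𝒪)`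
  (★ `mem_glInt_iff`: entries and inverse entries; `(reindexGL e (blockDiagGL X))⁻¹ = reindexGL e (blockDiagGL X⁻¹)`).
* §2 **`evalPlace_finPart_blkD_mem_localInt_iff`** — `(blkD (h₁,h₂))_v ∈ U(J^𝔻_V)(𝒪_v) ↔ (h₁)_v ∈ U(J^𝔻_{V₁})(𝒪_v) ∧ (h₂)_v ∈ U(J^𝔻_{V₂})(𝒪_v)` (★ `mem_localInt_iff` + §1 + ★ (e2));
  the corner cases `blkD_inr_mem_localInt_iff` (`(blkD (1,y))_v ∈ K_v ↔ y_v ∈ K⁽ᴮ⁾_v`), `blkD_inl_mem_localInt_iff`.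
* §3 **`blkD_inr_mul_mem_localInt`** — `y_v ∈ K⁽ᴮ⁾_v → g_v ∈ K_v → (blkD (1,y) · g)_v ∈ K_v`: off `T(g) ∪ {v : y_v ∉ K⁽ᴮ⁾_v}` the translated corner family's argument is
  integral — the place bookkeeping (e3)∕(KW1-c) run on (`U₁ μ g ⊇ T(g)`).
[PlatonovRapinchuk1994, §5.1 (`G_{𝒪_v}` of a matrix realisation)], [BorelJacquet1979, §4.1], [Kudla1994, §2].
HONEST LABEL.  Count-neutral helper, closes no socket: `HC_CM` is proved only modulo the 7 printed citations (2 remaining named inputs: hLiu418 =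
`stmt-HodgeConjecture-24832`, h413 = `stmt-HodgeConjecture-24833`) until rung 0 closes.

## References
* [PlatonovRapinchuk1994] V. Platonov, A. Rapinchuk, *Algebraic Groups and Number Theory* (1994), §5.1.
* [BorelJacquet1979] A. Borel, H. Jacquet, *Automorphic forms and automorphic representations*, Proc. Symp. Pure Math. 33.1 (1979), §4.1.
* [Kudla1994] S. S. Kudla, *Splitting metaplectic covers of dual reductive pairs*, Israel J. Math. 87 (1994), §2.
-/

set_option autoImplicit false
set_option linter.dupNamespace false -- the mandated namespace repeats `HodgeConjecture.HodgeConjecture`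

noncomputable section

open scoped Classical
open scoped Matrix
open NumberField IsDedekindDomain
open Literature.NumberTheory.Automorphic Literature.NumberTheory.GaloisRepresentations
open Literature.NumberTheory.GelbartRogawski1991 Literature.NumberTheory.GelbartRogawski1991.GRConstruction
open Literature.NumberTheory.GelbartRogawski1991.UnitaryDualPair
open Summit.HodgeConjecture.HodgeConjecture.Cruxes.HLiu418.K2LiuBlockDiagPlaces (coe_evalPlace_finPart_blkD)

namespace Summit.HodgeConjecture.HodgeConjecture.Cruxes.HLiu418.K2LiuBlockDiagIntegral

/-! ## §1 Block-diagonal matrices, re-indexed, are integral iff their blocks are -/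

/-- **`reindexGL e (blockDiagGL (X₁, X₂)) ∈ GL_k(𝒪_F) ↔ X₁ ∈ GL_{k₁}(𝒪_F) ∧ X₂ ∈ GL_{k₂}(𝒪_F)`** for any valued field `F` and any enumeration `e : Fin k₁ ⊕ Fin k₂ ≃ Fin k`:
the entries (and inverse entries) of the re-indexed block-diagonal matrix are those of the blocks and zeros (★ `mem_glInt_iff`). [cite: PlatonovRapinchuk1994, §5.1] -/
theorem reindexGL_blockDiagGL_mem_glInt_iff {F : Type*} [Field F] [ValuativeRel F] {k₁ k₂ k : ℕ} (e : Fin k₁ ⊕ Fin k₂ ≃ Fin k)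
    (X₁ : GL (Fin k₁) F) (X₂ : GL (Fin k₂) F) :
    UnitaryGroup.reindexGL e (UnitaryGroup.blockDiagGL (X₁, X₂)) ∈ glInt k F ↔ X₁ ∈ glInt k₁ F ∧ X₂ ∈ glInt k₂ F := by
  have hinv : (UnitaryGroup.reindexGL e (UnitaryGroup.blockDiagGL (X₁, X₂)))⁻¹ =
      UnitaryGroup.reindexGL e (UnitaryGroup.blockDiagGL (X₁⁻¹, X₂⁻¹)) := by
    rw [← map_inv, ← map_inv, Prod.inv_mk]
  have hent : ∀ (Y₁ : GL (Fin k₁) F) (Y₂ : GL (Fin k₂) F) (i j : Fin k),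
      ((UnitaryGroup.reindexGL e (UnitaryGroup.blockDiagGL (Y₁, Y₂)) : GL (Fin k) F) : Matrix (Fin k) (Fin k) F) i j =
        Matrix.fromBlocks (Y₁ : Matrix (Fin k₁) (Fin k₁) F) 0 0 (Y₂ : Matrix (Fin k₂) (Fin k₂) F) (e.symm i) (e.symm j) := fun Y₁ Y₂ i j => by
    rw [UnitaryGroup.coe_reindexGL, UnitaryGroup.coe_blockDiagGL, Matrix.reindex_apply, Matrix.submatrix_apply]
  rw [mem_glInt_iff, mem_glInt_iff, mem_glInt_iff, hinv]
  constructor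
  · rintro ⟨h1, h2⟩
    refine ⟨⟨fun a b => ?_, fun a b => ?_⟩, ⟨fun a b => ?_, fun a b => ?_⟩⟩
    · have h := h1 (e (Sum.inl a)) (e (Sum.inl b))
      rwa [hent, Equiv.symm_apply_apply, Equiv.symm_apply_apply, Matrix.fromBlocks_apply₁₁] at h
    · have h := h2 (e (Sum.inl a)) (e (Sum.inl b))
      rwa [hent, Equiv.symm_apply_apply, Equiv.symm_apply_apply, Matrix.fromBlocks_apply₁₁] at h
    · have h := h1 (e (Sum.inr a)) (e (Sum.inr b))
      rwa [hent, Equiv.symm_apply_apply, Equiv.symm_apply_apply, Matrix.fromBlocks_apply₂₂] at h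
    · have h := h2 (e (Sum.inr a)) (e (Sum.inr b))
      rwa [hent, Equiv.symm_apply_apply, Equiv.symm_apply_apply, Matrix.fromBlocks_apply₂₂] at h
  · rintro ⟨⟨h1, h1'⟩, ⟨h2, h2'⟩⟩
    refine ⟨fun i j => ?_, fun i j => ?_⟩
    · rw [hent]
      generalize e.symm i = z
      generalize e.symm j = z'
      rcases z with a | a <;> rcases z' with b | b
      · rw [Matrix.fromBlocks_apply₁₁]; exact h1 a b
      · rw [Matrix.fromBlocks_apply₁₂, Matrix.zero_apply]; exact zero_mem _
      · rw [Matrix.fromBlocks_apply₂₁, Matrix.zero_apply]; exact zero_mem _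
      · rw [Matrix.fromBlocks_apply₂₂]; exact h2 a b
    · rw [hent]
      generalize e.symm i = z
      generalize e.symm j = z'
      rcases z with a | a <;> rcases z' with b | b
      · rw [Matrix.fromBlocks_apply₁₁]; exact h1' a b
      · rw [Matrix.fromBlocks_apply₁₂, Matrix.zero_apply]; exact zero_mem _
      · rw [Matrix.fromBlocks_apply₂₁, Matrix.zero_apply]; exact zero_mem _
      · rw [Matrix.fromBlocks_apply₂₂]; exact h2' a b

/-! ## §2 The place components of `blkD (h₁, h₂)` are integral iff the components' are -/

variable (L : Type) [Field L] [NumberField L] [IsCMField L]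
variable {N₁ N₂ M n n₁ n₂ : ℕ} (eV : Fin (N₁ + N₂) × Fin M ≃ Fin n) (eA : Fin N₁ × Fin M ≃ Fin n₁) (eB : Fin N₂ × Fin M ≃ Fin n₂)
  (dA : Fin N₁ → L) (hdA : ∀ i, IsCMField.complexConj L (dA i) = dA i)
  (dB : Fin N₂ → L) (hdB : ∀ i, IsCMField.complexConj L (dB i) = dB i)
  (dV : Fin (N₁ + N₂) → L) (hdV : ∀ i, IsCMField.complexConj L (dV i) = dV i)
  (hVA : ∀ i, dV (Fin.castAdd N₂ i) = dA i) (hVB : ∀ j, dV (Fin.natAdd N₁ j) = dB j)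
  (dW : Fin M → L) (hdW : ∀ i, IsCMField.complexConj L (dW i) = dW i)

set_option maxHeartbeats 400000 in
/-- **`(blkD (h₁,h₂))_v ∈ U(J^𝔻_V)(𝒪_v) ↔ (h₁)_v ∈ U(J^𝔻_{V₁})(𝒪_v) ∧ (h₂)_v ∈ U(J^𝔻_{V₂})(𝒪_v)`** at every finite place `v` of `L⁺` (★ `mem_localInt_iff` block by block `w ∣ v`, ★ (e2)
`coe_evalPlace_finPart_blkD`, §1). [cite: PlatonovRapinchuk1994, §5.1] [cite: Kudla1994, §2] -/
theorem evalPlace_finPart_blkD_mem_localInt_iff (h : HA L eA dA hdA dW hdW × HA L eB dB hdB dW hdW) (v : HeightOneSpectrum (𝓞 (Fp L))) :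
    UnitaryGroup.evalPlace (Fp L) L (IsCMField.complexConj L) (n + n) (hermD L eV dV hdV dW hdW) v
        (UnitaryGroup.finPart (Fp L) L (IsCMField.complexConj L) (n + n) (hermD L eV dV hdV dW hdW) (blkD L eV eA eB dA hdA dB hdB dV hdV hVA hVB dW hdW h)) ∈
        UnitaryGroup.localInt L (IsCMField.complexConj L) (n + n) (hermD L eV dV hdV dW hdW) v ↔
      UnitaryGroup.evalPlace (Fp L) L (IsCMField.complexConj L) (n₁ + n₁) (hermD L eA dA hdA dW hdW) v
          (UnitaryGroup.finPart (Fp L) L (IsCMField.complexConj L) (n₁ + n₁) (hermD L eA dA hdA dW hdW) h.1) ∈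
          UnitaryGroup.localInt L (IsCMField.complexConj L) (n₁ + n₁) (hermD L eA dA hdA dW hdW) v ∧
        UnitaryGroup.evalPlace (Fp L) L (IsCMField.complexConj L) (n₂ + n₂) (hermD L eB dB hdB dW hdW) v
            (UnitaryGroup.finPart (Fp L) L (IsCMField.complexConj L) (n₂ + n₂) (hermD L eB dB hdB dW hdW) h.2) ∈
          UnitaryGroup.localInt L (IsCMField.complexConj L) (n₂ + n₂) (hermD L eB dB hdB dW hdW) v := by
  rw [UnitaryGroup.mem_localInt_iff, UnitaryGroup.mem_localInt_iff, UnitaryGroup.mem_localInt_iff, ← forall_and]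
  refine forall_congr' fun w => ?_
  rw [coe_evalPlace_finPart_blkD, reindexGL_blockDiagGL_mem_glInt_iff]

/-- **corner case: `(blkD (1, y))_v ∈ K_v ↔ y_v ∈ K⁽ᴮ⁾_v`** — the see-saw chart of the translated corner family PRESERVES AND REFLECTS integrality at every finite place (the
`m = 0` case of (KW1-c)'s `hιK`). [cite: PlatonovRapinchuk1994, §5.1] [cite: Kudla1994, §2] -/
theorem blkD_inr_mem_localInt_iff (y : HA L eB dB hdB dW hdW) (v : HeightOneSpectrum (𝓞 (Fp L))) :
    UnitaryGroup.evalPlace (Fp L) L (IsCMField.complexConj L) (n + n) (hermD L eV dV hdV dW hdW) v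
        (UnitaryGroup.finPart (Fp L) L (IsCMField.complexConj L) (n + n) (hermD L eV dV hdV dW hdW)
          (blkD L eV eA eB dA hdA dB hdB dV hdV hVA hVB dW hdW (1, y))) ∈
        UnitaryGroup.localInt L (IsCMField.complexConj L) (n + n) (hermD L eV dV hdV dW hdW) v ↔
      UnitaryGroup.evalPlace (Fp L) L (IsCMField.complexConj L) (n₂ + n₂) (hermD L eB dB hdB dW hdW) v
          (UnitaryGroup.finPart (Fp L) L (IsCMField.complexConj L) (n₂ + n₂) (hermD L eB dB hdB dW hdW) y) ∈
        UnitaryGroup.localInt L (IsCMField.complexConj L) (n₂ + n₂) (hermD L eB dB hdB dW hdW) v := by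
  have h1 : UnitaryGroup.finPart (Fp L) L (IsCMField.complexConj L) (n₁ + n₁) (hermD L eA dA hdA dW hdW) (1 : HA L eA dA hdA dW hdW) = 1 := map_one _
  rw [evalPlace_finPart_blkD_mem_localInt_iff]
  dsimp only
  rw [h1, map_one]
  exact ⟨fun h => h.2, fun h => ⟨one_mem _, h⟩⟩

/-- the first-summand twin: `(blkD (x, 1))_v ∈ K_v ↔ x_v ∈ K⁽ᴬ⁾_v`. [cite: PlatonovRapinchuk1994, §5.1] [cite: Kudla1994, §2] -/
theorem blkD_inl_mem_localInt_iff (x : HA L eA dA hdA dW hdW) (v : HeightOneSpectrum (𝓞 (Fp L))) :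
    UnitaryGroup.evalPlace (Fp L) L (IsCMField.complexConj L) (n + n) (hermD L eV dV hdV dW hdW) v
        (UnitaryGroup.finPart (Fp L) L (IsCMField.complexConj L) (n + n) (hermD L eV dV hdV dW hdW)
          (blkD L eV eA eB dA hdA dB hdB dV hdV hVA hVB dW hdW (x, 1))) ∈
        UnitaryGroup.localInt L (IsCMField.complexConj L) (n + n) (hermD L eV dV hdV dW hdW) v ↔
      UnitaryGroup.evalPlace (Fp L) L (IsCMField.complexConj L) (n₁ + n₁) (hermD L eA dA hdA dW hdW) v
          (UnitaryGroup.finPart (Fp L) L (IsCMField.complexConj L) (n₁ + n₁) (hermD L eA dA hdA dW hdW) x) ∈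
        UnitaryGroup.localInt L (IsCMField.complexConj L) (n₁ + n₁) (hermD L eA dA hdA dW hdW) v := by
  have h1 : UnitaryGroup.finPart (Fp L) L (IsCMField.complexConj L) (n₂ + n₂) (hermD L eB dB hdB dW hdW) (1 : HA L eB dB hdB dW hdW) = 1 := map_one _
  rw [evalPlace_finPart_blkD_mem_localInt_iff]
  dsimp only
  rw [h1, map_one]
  exact ⟨fun h => h.1, fun h => ⟨h, one_mem _⟩⟩

/-! ## §3 The place bookkeeping of the translated corner family -/

/-- **off `T(g) ∪ {v : y_v ∉ K⁽ᴮ⁾_v}` the argument `blkD (1,y) · g` of the translated corner family is integral at `v`**: `y_v ∈ K⁽ᴮ⁾_v → g_v ∈ K_v → (blkD (1,y) · g)_v ∈ K_v`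
(§2 + `map_mul` + `mul_mem`) — so the exceptional place set of `x ↦ f_s(p₀ · blkD(1,x) · g)` at `x = y` is contained in `T(g) ∪ {v : y_v ∉ K⁽ᴮ⁾_v}` (line lead's
`U₁ μ g ⊇ T(g)`). [cite: PlatonovRapinchuk1994, §5.1] [cite: BorelJacquet1979, §4.1] -/
theorem blkD_inr_mul_mem_localInt {y : HA L eB dB hdB dW hdW} {g : HA L eV dV hdV dW hdW} {v : HeightOneSpectrum (𝓞 (Fp L))}
    (hy : UnitaryGroup.evalPlace (Fp L) L (IsCMField.complexConj L) (n₂ + n₂) (hermD L eB dB hdB dW hdW) v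
        (UnitaryGroup.finPart (Fp L) L (IsCMField.complexConj L) (n₂ + n₂) (hermD L eB dB hdB dW hdW) y) ∈
      UnitaryGroup.localInt L (IsCMField.complexConj L) (n₂ + n₂) (hermD L eB dB hdB dW hdW) v)
    (hg : UnitaryGroup.evalPlace (Fp L) L (IsCMField.complexConj L) (n + n) (hermD L eV dV hdV dW hdW) v
        (UnitaryGroup.finPart (Fp L) L (IsCMField.complexConj L) (n + n) (hermD L eV dV hdV dW hdW) g) ∈
      UnitaryGroup.localInt L (IsCMField.complexConj L) (n + n) (hermD L eV dV hdV dW hdW) v) :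
    UnitaryGroup.evalPlace (Fp L) L (IsCMField.complexConj L) (n + n) (hermD L eV dV hdV dW hdW) v
        (UnitaryGroup.finPart (Fp L) L (IsCMField.complexConj L) (n + n) (hermD L eV dV hdV dW hdW)
          (blkD L eV eA eB dA hdA dB hdB dV hdV hVA hVB dW hdW (1, y) * g)) ∈
      UnitaryGroup.localInt L (IsCMField.complexConj L) (n + n) (hermD L eV dV hdV dW hdW) v := by
  have hmul : UnitaryGroup.finPart (Fp L) L (IsCMField.complexConj L) (n + n) (hermD L eV dV hdV dW hdW) (blkD L eV eA eB dA hdA dB hdB dV hdV hVA hVB dW hdW (1, y) * g) =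
      UnitaryGroup.finPart (Fp L) L (IsCMField.complexConj L) (n + n) (hermD L eV dV hdV dW hdW) (blkD L eV eA eB dA hdA dB hdB dV hdV hVA hVB dW hdW (1, y)) *
        UnitaryGroup.finPart (Fp L) L (IsCMField.complexConj L) (n + n) (hermD L eV dV hdV dW hdW) g := map_mul _ _ _
  rw [hmul, map_mul]
  exact mul_mem ((blkD_inr_mem_localInt_iff L eV eA eB dA hdA dB hdB dV hdV hVA hVB dW hdW y v).2 hy) hg

/-- … and conversely, at a place where `g_v ∈ K_v`, the translated argument is integral iff `y_v` is: `g_v ∈ K_v → ((blkD (1,y) · g)_v ∈ K_v ↔ y_v ∈ K⁽ᴮ⁾_v)` — the exceptional set of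
the translated corner family off `T(g)` is EXACTLY `{v : y_v ∉ K⁽ᴮ⁾_v}`. [cite: PlatonovRapinchuk1994, §5.1] [cite: BorelJacquet1979, §4.1] -/
theorem blkD_inr_mul_mem_localInt_iff {g : HA L eV dV hdV dW hdW} {v : HeightOneSpectrum (𝓞 (Fp L))}
    (hg : UnitaryGroup.evalPlace (Fp L) L (IsCMField.complexConj L) (n + n) (hermD L eV dV hdV dW hdW) v
        (UnitaryGroup.finPart (Fp L) L (IsCMField.complexConj L) (n + n) (hermD L eV dV hdV dW hdW) g) ∈
      UnitaryGroup.localInt L (IsCMField.complexConj L) (n + n) (hermD L eV dV hdV dW hdW) v) (y : HA L eB dB hdB dW hdW) :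
    UnitaryGroup.evalPlace (Fp L) L (IsCMField.complexConj L) (n + n) (hermD L eV dV hdV dW hdW) v
        (UnitaryGroup.finPart (Fp L) L (IsCMField.complexConj L) (n + n) (hermD L eV dV hdV dW hdW)
          (blkD L eV eA eB dA hdA dB hdB dV hdV hVA hVB dW hdW (1, y) * g)) ∈
        UnitaryGroup.localInt L (IsCMField.complexConj L) (n + n) (hermD L eV dV hdV dW hdW) v ↔
      UnitaryGroup.evalPlace (Fp L) L (IsCMField.complexConj L) (n₂ + n₂) (hermD L eB dB hdB dW hdW) v
          (UnitaryGroup.finPart (Fp L) L (IsCMField.complexConj L) (n₂ + n₂) (hermD L eB dB hdB dW hdW) y) ∈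
        UnitaryGroup.localInt L (IsCMField.complexConj L) (n₂ + n₂) (hermD L eB dB hdB dW hdW) v := by
  have hmul : UnitaryGroup.finPart (Fp L) L (IsCMField.complexConj L) (n + n) (hermD L eV dV hdV dW hdW) (blkD L eV eA eB dA hdA dB hdB dV hdV hVA hVB dW hdW (1, y) * g) =
      UnitaryGroup.finPart (Fp L) L (IsCMField.complexConj L) (n + n) (hermD L eV dV hdV dW hdW) (blkD L eV eA eB dA hdA dB hdB dV hdV hVA hVB dW hdW (1, y)) *
        UnitaryGroup.finPart (Fp L) L (IsCMField.complexConj L) (n + n) (hermD L eV dV hdV dW hdW) g := map_mul _ _ _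
  rw [hmul, map_mul]
  rw [Subgroup.mul_mem_cancel_right _ hg]
  exact blkD_inr_mem_localInt_iff L eV eA eB dA hdA dB hdB dV hdV hVA hVB dW hdW y v

end Summit.HodgeConjecture.HodgeConjecture.Cruxes.HLiu418.K2LiuBlockDiagIntegral

end
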